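import Literature.Topology.FourManifolds.CylinderTwistExtension
import Literature.Topology.FourManifolds.CylinderReflection
import Literature.Topology.FourManifolds.RegularLevelSplitOrientation
import Literature.Topology.FourManifolds.GluingIsotopyProofs
import Literature.Topology.FourManifolds.HomotopySpheresProofs
import Literature.Topology.FourManifolds.OrientationDiffeotopy
import Literature.Topology.FourManifolds.SurfaceLevelCylinders
import HarnessLib

/-!
# Uniqueness of the torus: two closed oriented surfaces with Morse functions of type `(1, 2, 1)` are diffeomorphic

Topic `Literature/Topology/FourManifolds`; written for the fact seat
`provefact-Literature.Topology.FourManifolds.nonempty_diffeomorph_sphere_four_of_sblf_genus_one_noLefschetz`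
(Baykur–Kamada 2015, Lemma 11: the genus-one fibres of a simplified broken Lefschetz fibration
are tori — the classification of closed oriented surfaces in genus one).  Everything here is
**proved**; no named facts.

## Mathematics

**Theorem** (`nonempty_diffeomorph_of_cylinder_halves`).  Let `M₁`, `M₂` be compact smooth
surfaces without boundary, oriented, each cut along a regular level of a smooth function into a
sublevel half `Sᵢ = {gᵢ ≤ cᵢ}` and a superlevel half `Sᵢ' = {cᵢ ≤ gᵢ}` both diffeomorphic to the
annulus `𝕊¹ × [0, 1]`.  Then `M₁ ≅ M₂`.

With the cutting theorem of `SurfaceLevelCylinders.lean` (a closed oriented surface carrying a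
Morse function with one minimum, two saddles and one maximum is cut by a suitable regular level
into two annuli) this gives **the uniqueness of the torus**
(`nonempty_diffeomorph_of_isMorse_one_two_one`): *any two closed oriented surfaces admitting Morse
functions of type `(1, 2, 1)` are diffeomorphic* (Hirsch, *Differential Topology* (1976), Ch. 9
§3, Thm. 3.5 and Thm. 3.7 with genus `1`; Matsumoto, *An introduction to Morse theory* (2001),
§1.5 (b): "the closed surface with a Morse function with one minimum, two saddles and one maximum
is the torus").

**Proof** (Hirsch, Ch. 8 §2, Thms. 2.1–2.3, and Ch. 9 §3).  `Mᵢ = Sᵢ ∪_{σᵢ} Sᵢ'` is the gluing of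
its two halves along the identification `σᵢ : ∂Sᵢ ≅ ∂Sᵢ'` of their boundaries
(`RegularSublevel.isBoundaryGluing_split`).  Choose diffeomorphisms `A : S₁ ≅ S₂`, `B : S₁' ≅ S₂'`
(all four halves are annuli); then `M₂` is also the gluing of `S₁` and `S₁'` along
`ψ = ∂A ≫ σ₂ ≫ ∂B⁻¹` (`IsBoundaryGluing.of_diffeomorph_pieces`), and it remains to extend the
*twist* `σ₁⁻¹ ≫ ψ ∈ Diff ∂S₁'` to a diffeomorphism of `S₁'` (re-gluing,
`IsBoundaryGluing.comp_diffeomorph_right`, and uniqueness of the `σ₁`-gluing,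
`nonempty_diffeomorph_of_isBoundaryGluing_holds`).  By the extension theorem for annuli
(`exists_diffeomorph_extends_of_isOrientationPreserving`, `CylinderTwistExtension.lean`: Cerf's
`π₀ Diff⁺(S¹) = 0` and the double slide) it suffices that the twist map each boundary circle of
`S₁'` to itself and preserve the boundary orientation.  The first is arranged by composing `B`
with the end swap of the annulus `S₁'` if necessary (the twist permutes the two boundary circles,
`forall_snd_eq_or_forall_snd_eq_flipIcc`); the second by composing `B` with the reflection of the
annulus `S₁'` (`CylinderReflection.lean`) if necessary: the orientation character of the twist is
the product of those of `A` and `B`, because the identifications `σᵢ` reverse the boundary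
orientations induced from the two sides (`RegularSublevel.isOrientationReversing_splitDiffeomorph`,
`RegularLevelSplitOrientation.lean`) and boundary restrictions of diffeomorphisms have the
character of the diffeomorphism (`BoundaryOrientation.lean`).

## References

* M. W. Hirsch, *Differential Topology*, GTM 33 (1976), Ch. 8 §2 (Thms. 2.1–2.3), Ch. 9 §3
  (Thms. 3.5, 3.7: classification of compact orientable surfaces). [HirschDT1976]
* Y. Matsumoto, *An introduction to Morse theory*, AMS (2001), §1.5. [Matsumoto2001]
* R. İ. Baykur, S. Kamada, *Classification of broken Lefschetz fibrations with small fiber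
  genera*, J. Math. Soc. Japan 67 (2015), Lemma 11. [BaykurKamada2015]
-/

open scoped Manifold ContDiff Topology
open Function Set Filter Module

noncomputable section

namespace Literature.Topology.FourManifolds

universe u

/-! ### §1 Transport of a gluing along diffeomorphisms of the pieces -/

section Transport

variable {n : ℕ} {EP HP : Type*} [NormedAddCommGroup EP] [NormedSpace ℝ EP] [TopologicalSpace HP]
  {IP : ModelWithCorners ℝ EP HP}
  {A A' B B' : Type u} [TopologicalSpace A] [ChartedSpace (EuclideanHalfSpace (n + 1)) A]
  [IsManifold (𝓡∂ (n + 1)) ∞ A] [TopologicalSpace A'] [ChartedSpace (EuclideanHalfSpace (n + 1)) A']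
  [IsManifold (𝓡∂ (n + 1)) ∞ A'] [TopologicalSpace B] [ChartedSpace (EuclideanHalfSpace (n + 1)) B]
  [IsManifold (𝓡∂ (n + 1)) ∞ B] [TopologicalSpace B'] [ChartedSpace (EuclideanHalfSpace (n + 1)) B']
  [IsManifold (𝓡∂ (n + 1)) ∞ B'] {Q : Type*} [TopologicalSpace Q] [ChartedSpace HP Q]
  {bA : BoundaryData (𝓡∂ (n + 1)) A (𝓡 n)} {bA' : BoundaryData (𝓡∂ (n + 1)) A' (𝓡 n)}
  {bB : BoundaryData (𝓡∂ (n + 1)) B (𝓡 n)} {bB' : BoundaryData (𝓡∂ (n + 1)) B' (𝓡 n)}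

/-- **Transport of a gluing along diffeomorphisms of the pieces.** If `Q = A' ∪_φ B'` and
`α : A ≅ A'`, `β : B ≅ B'` are diffeomorphisms, then `Q = A ∪_ψ B` with
`ψ = ∂α ≫ φ ≫ (∂β)⁻¹` (`∂α`, `∂β` the boundary restrictions, `BoundaryData.restrictDiffeomorph`):
replace the embeddings `jA'`, `jB'` by `jA' ∘ α`, `jB' ∘ β`. Hirsch, *Differential Topology*
(1976), Ch. 8 §2, Thm. 2.2. [cite: HirschDT1976, Ch. 8 §2, Thm. 2.2] -/
theorem IsBoundaryGluing.of_diffeomorph_pieces {φ : bA'.carrier ≃ₘ⟮𝓡 n, 𝓡 n⟯ bB'.carrier}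
    (h : IsBoundaryGluing bA' bB' φ IP Q) (α : A ≃ₘ⟮𝓡∂ (n + 1), 𝓡∂ (n + 1)⟯ A')
    (β : B ≃ₘ⟮𝓡∂ (n + 1), 𝓡∂ (n + 1)⟯ B') :
    IsBoundaryGluing bA bB
      ((bA.restrictDiffeomorph bA' α).trans (φ.trans (bB.restrictDiffeomorph bB' β).symm)) IP Q := by
  obtain ⟨jA, jB, hjA, hjB, hU, hR⟩ := h
  refine ⟨jA ∘ α, jB ∘ β, hjA.comp_diffeomorph α, hjB.comp_diffeomorph β, ?_, fun a b => ?_⟩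
  · rw [(EquivLike.surjective α).range_comp, (EquivLike.surjective β).range_comp]
    exact hU
  · rw [comp_apply, comp_apply, hR]
    constructor
    · rintro ⟨z', ha, hb⟩
      refine ⟨(bA.restrictDiffeomorph bA' α).symm z', ?_, ?_⟩
      · rw [BoundaryData.restrictDiffeomorph_symm, BoundaryData.coe_restrictDiffeomorph,
          BoundaryData.incl_restrictEquiv, ← ha, Diffeomorph.symm_apply_apply]
      · rw [Diffeomorph.coe_trans, Diffeomorph.coe_trans, comp_apply, comp_apply,
          Diffeomorph.apply_symm_apply, BoundaryData.restrictDiffeomorph_symm,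
          BoundaryData.coe_restrictDiffeomorph, BoundaryData.incl_restrictEquiv, ← hb,
          Diffeomorph.symm_apply_apply]
    · rintro ⟨z, rfl, rfl⟩
      refine ⟨bA.restrictDiffeomorph bA' α z, ?_, ?_⟩
      · rw [BoundaryData.coe_restrictDiffeomorph, BoundaryData.incl_restrictEquiv]
      · rw [Diffeomorph.coe_trans, Diffeomorph.coe_trans, comp_apply, comp_apply,
          BoundaryData.restrictDiffeomorph_symm, BoundaryData.coe_restrictDiffeomorph,
          BoundaryData.incl_restrictEquiv, Diffeomorph.apply_symm_apply,
          BoundaryData.coe_restrictDiffeomorph]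

end Transport

/-! ### §2 A diffeomorphism of the boundary of a cylinder preserves or exchanges the ends -/

section EndDichotomy

open SmoothFill

variable {n : ℕ} {W : Type u} [TopologicalSpace W] [ChartedSpace (EuclideanHalfSpace (n + 1)) W]
  [IsManifold (𝓡∂ (n + 1)) ∞ W]
  {N : Type*} [TopologicalSpace N] [ChartedSpace (EuclideanSpace ℝ (Fin n)) N]

/-- **A self-diffeomorphism of the boundary of a cylinder with connected base either maps each
end to itself or exchanges the two ends**: the ends are the two connected, open, complementary
pieces of `∂W`, permuted by any homeomorphism. [folklore] -/
theorem forall_snd_eq_or_forall_snd_eq_flipIcc [Nonempty N] [PreconnectedSpace N]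
    (T : W ≃ₘ⟮𝓡∂ (n + 1), (𝓡 n).prod (𝓡∂ 1)⟯ (N × Set.Icc (0 : ℝ) 1))
    (χ : (𝓡∂ (n + 1)).boundary W ≃ₘ⟮𝓡 n, 𝓡 n⟯ (𝓡∂ (n + 1)).boundary W) :
    (∀ w, (T (χ w).1).2 = (T w.1).2) ∨ (∀ w, (T (χ w).1).2 = flipIcc (T w.1).2) := by
  set E₀ : Set ((𝓡∂ (n + 1)).boundary W) := {w | (T w.1).2 = ⊥} with hE₀
  set E₁ : Set ((𝓡∂ (n + 1)).boundary W) := {w | (T w.1).2 = ⊤} with hE₁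
  have h0 : IsOpen E₀ := isOpen_setOf_snd_eq T (Or.inl rfl)
  have h1 : IsOpen E₁ := isOpen_setOf_snd_eq T (Or.inr rfl)
  have hbt : (⊥ : Set.Icc (0 : ℝ) 1) ≠ ⊤ := by
    intro h
    have := congrArg (fun t : Set.Icc (0 : ℝ) 1 => (t : ℝ)) h
    simp only [Set.Icc.coe_bot, Set.Icc.coe_top] at this
    exact zero_ne_one this
  have hdisj : Disjoint E₀ E₁ := by
    rw [Set.disjoint_left]
    intro w hw hw'
    exact hbt (hw.symm.trans hw')
  have hcover : ∀ s : Set ((𝓡∂ (n + 1)).boundary W), s ⊆ E₀ ∪ E₁ := fun s w _ =>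
    snd_eq_bot_or_eq_top T w
  have hpre : ∀ {e : Set.Icc (0 : ℝ) 1} (he : e = ⊥ ∨ e = ⊤),
      IsPreconnected (⇑χ '' {w : (𝓡∂ (n + 1)).boundary W | (T w.1).2 = e}) := fun he =>
    (isPreconnected_setOf_snd_eq T he).image _ χ.continuous.continuousOn
  obtain ⟨x₀⟩ := ‹Nonempty N›
  have hne : ∀ {e : Set.Icc (0 : ℝ) 1} (he : e = ⊥ ∨ e = ⊤),
      ∃ w : (𝓡∂ (n + 1)).boundary W, (T w.1).2 = e := fun he =>
    ⟨endSection T _ he x₀, by rw [apply_coe_endSection]⟩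
  -- images of the ends
  have hi0 := (hpre (Or.inl rfl)).subset_or_subset h0 h1 hdisj (hcover _)
  have hi1 := (hpre (Or.inr rfl)).subset_or_subset h0 h1 hdisj (hcover _)
  -- surjectivity excludes both images in the same end
  have key : ∀ {e e' : Set.Icc (0 : ℝ) 1} (he : e = ⊥ ∨ e = ⊤) (he' : e' = ⊥ ∨ e' = ⊤),
      e ≠ e' → ¬ (⇑χ '' E₀ ⊆ {w | (T w.1).2 = e} ∧ ⇑χ '' E₁ ⊆ {w | (T w.1).2 = e}) := by
    intro e e' he he' hee' ⟨hs0, hs1⟩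
    obtain ⟨w₁, hw₁⟩ := hne he'
    obtain ⟨w, rfl⟩ := χ.surjective w₁
    rcases snd_eq_bot_or_eq_top T w with hw | hw
    · exact hee' ((hs0 ⟨w, hw, rfl⟩ : (T (χ w).1).2 = e).symm.trans hw₁)
    · exact hee' ((hs1 ⟨w, hw, rfl⟩ : (T (χ w).1).2 = e).symm.trans hw₁)
  rcases hi0 with hi0 | hi0 <;> rcases hi1 with hi1 | hi1
  · exact absurd ⟨hi0, hi1⟩ (key (Or.inl rfl) (Or.inr rfl) hbt)
  · left
    intro w
    rcases snd_eq_bot_or_eq_top T w with hw | hw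
    · rw [hw]; exact hi0 ⟨w, hw, rfl⟩
    · rw [hw]; exact hi1 ⟨w, hw, rfl⟩
  · right
    intro w
    rcases snd_eq_bot_or_eq_top T w with hw | hw
    · rw [hw, flipIcc_bot]; exact hi0 ⟨w, hw, rfl⟩
    · rw [hw, flipIcc_top]; exact hi1 ⟨w, hw, rfl⟩
  · exact absurd ⟨hi0, hi1⟩ (key (Or.inr rfl) (Or.inl rfl) hbt.symm)

end EndDichotomy

/-! ### §3 Orientation bookkeeping for diffeomorphisms -/

section OrientationLemmas

variable {E H H' : Type*} [NormedAddCommGroup E] [NormedSpace ℝ E] [TopologicalSpace H]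
  [TopologicalSpace H'] {I : ModelWithCorners ℝ E H} {I' : ModelWithCorners ℝ E H'}
  {M : Type*} [TopologicalSpace M] [ChartedSpace H M] [IsManifold I 1 M]
  {N : Type*} [TopologicalSpace N] [ChartedSpace H' N] [IsManifold I' 1 N]

/-- Composition with an orientation-reversing self-diffeomorphism of a connected manifold flips the
orientation character. [folklore] -/
theorem isOrientationPreserving_trans_iff_not_of_isOrientationReversing [ConnectedSpace M]
    {R : M ≃ₘ⟮I, I⟯ M} {oM : SmoothOrientation I M} (hR : R.IsOrientationReversing oM oM)
    (φ : M ≃ₘ⟮I, I'⟯ N) (oN : SmoothOrientation I' N) :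
    (R.trans φ).IsOrientationPreserving oM oN ↔ ¬ φ.IsOrientationPreserving oM oN := by
  have hR' : R.IsOrientationPreserving oM (-oM) := hR
  constructor
  · intro h hφ
    -- `φ : -oM → -oN` preserving, so `R ≫ φ : oM → -oN` preserving, i.e. reversing
    have hφ' : φ.IsOrientationPreserving (-oM) (-oN) :=
      (isOrientationPreserving_neg_neg_iff oM oN φ).mpr hφ
    have hrev : (R.trans φ).IsOrientationPreserving oM (-oN) :=
      Diffeomorph.IsOrientationPreserving.trans_holds hR' hφ' (by simp)
    exact (IsOrientationPreserving.not_isOrientationReversing h) hrev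
  · intro hφ
    rcases Diffeomorph.isOrientationPreserving_or_isOrientationReversing_holds φ (by simp) oM oN
      with h | h
    · exact absurd h hφ
    · have h' : IsOrientationPreserving (-oM) oN ⇑φ := by
        rw [← isOrientationPreserving_neg_neg_iff, neg_neg]
        exact h
      exact Diffeomorph.IsOrientationPreserving.trans_holds hR' h' (by simp)

end OrientationLemmas

/-! ### §4 The assembly -/

section Assembly

variable {M₁ : Type u} [TopologicalSpace M₁] [T2Space M₁] [CompactSpace M₁]
  [ChartedSpace (EuclideanSpace ℝ (Fin 2)) M₁] [IsManifold (𝓡 2) ∞ M₁]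
  {M₂ : Type u} [TopologicalSpace M₂] [ChartedSpace (EuclideanSpace ℝ (Fin 2)) M₂] [IsManifold (𝓡 2) ∞ M₂]

set_option maxHeartbeats 800000 in
/-- **Two oriented closed surfaces cut into two annuli each are diffeomorphic** (the assembly
step of the uniqueness of the torus; see the module docstring for the proof). Hirsch,
*Differential Topology* (1976), Ch. 8 §2, Thms. 2.1–2.3, and Ch. 9 §3.
[cite: HirschDT1976, Ch. 9 §3, Thm. 3.5 and Thm. 3.7] -/
theorem nonempty_diffeomorph_of_cylinder_halves
    {g₁ : M₁ → ℝ} {c₁ : ℝ} (h₁ : IsRegularLevel (𝓡 2) g₁ c₁) (o₁ : SmoothOrientation (𝓡 2) M₁)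
    (T₁ : RegularSublevel h₁ ≃ₘ⟮𝓡∂ (1 + 1), (𝓡 1).prod (𝓡∂ 1)⟯
      ((Metric.sphere (0 : EuclideanSpace ℝ (Fin (1 + 1))) 1) × Set.Icc (0 : ℝ) 1))
    (T₁' : RegularSuperlevel h₁ ≃ₘ⟮𝓡∂ (1 + 1), (𝓡 1).prod (𝓡∂ 1)⟯
      ((Metric.sphere (0 : EuclideanSpace ℝ (Fin (1 + 1))) 1) × Set.Icc (0 : ℝ) 1))
    {g₂ : M₂ → ℝ} {c₂ : ℝ} (h₂ : IsRegularLevel (𝓡 2) g₂ c₂) (o₂ : SmoothOrientation (𝓡 2) M₂)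
    (T₂ : RegularSublevel h₂ ≃ₘ⟮𝓡∂ (1 + 1), (𝓡 1).prod (𝓡∂ 1)⟯
      ((Metric.sphere (0 : EuclideanSpace ℝ (Fin (1 + 1))) 1) × Set.Icc (0 : ℝ) 1))
    (T₂' : RegularSuperlevel h₂ ≃ₘ⟮𝓡∂ (1 + 1), (𝓡 1).prod (𝓡∂ 1)⟯
      ((Metric.sphere (0 : EuclideanSpace ℝ (Fin (1 + 1))) 1) × Set.Icc (0 : ℝ) 1)) :
    Nonempty (M₁ ≃ₘ⟮𝓡 2, 𝓡 2⟯ M₂) := by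
  -- the four halves are connected (annuli)
  haveI : ConnectedSpace (RegularSublevel h₁) := connectedSpace_of_diffeomorph_annulus T₁
  haveI : ConnectedSpace (RegularSuperlevel h₁) := connectedSpace_of_diffeomorph_annulus T₁'
  haveI : ConnectedSpace (RegularSublevel h₂) := connectedSpace_of_diffeomorph_annulus T₂
  haveI : ConnectedSpace (RegularSuperlevel h₂) := connectedSpace_of_diffeomorph_annulus T₂'
  -- orientations of the halves and of their boundaries
  set ω₁ := RegularSublevel.orientation h₁ o₁ with hω₁
  set ω₁' := RegularSublevel.orientation h₁.const_sub o₁ with hω₁'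
  set ω₂ := RegularSublevel.orientation h₂ o₂ with hω₂
  set ω₂' := RegularSublevel.orientation h₂.const_sub o₂ with hω₂'
  -- boundary data and the identifications `σᵢ : ∂Sᵢ ≅ ∂Sᵢ'`
  set b₁ := RegularSublevel.boundaryData h₁ with hb₁
  set b₁' := RegularSublevel.boundaryData h₁.const_sub with hb₁'
  set b₂ := RegularSublevel.boundaryData h₂ with hb₂
  set b₂' := RegularSublevel.boundaryData h₂.const_sub with hb₂'
  set σ₁ := RegularSublevel.splitDiffeomorph h₁ with hσ₁
  set σ₂ := RegularSublevel.splitDiffeomorph h₂ with hσ₂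
  have hσ₁ : σ₁.IsOrientationPreserving ω₁.boundary (-ω₁'.boundary) :=
    RegularSublevel.isOrientationReversing_splitDiffeomorph h₁ o₁
  have hσ₂ : σ₂.IsOrientationPreserving ω₂.boundary (-ω₂'.boundary) :=
    RegularSublevel.isOrientationReversing_splitDiffeomorph h₂ o₂
  -- the gluing diffeomorphism `ψ A B = ∂A ≫ σ₂ ≫ ∂B⁻¹` and the twist `σ₁⁻¹ ≫ ψ A B`
  let ψ : (RegularSublevel h₁ ≃ₘ⟮𝓡∂ (1 + 1), 𝓡∂ (1 + 1)⟯ RegularSublevel h₂) →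
      (RegularSuperlevel h₁ ≃ₘ⟮𝓡∂ (1 + 1), 𝓡∂ (1 + 1)⟯ RegularSuperlevel h₂) →
      (b₁.carrier ≃ₘ⟮𝓡 1, 𝓡 1⟯ b₁'.carrier) := fun A B =>
    (b₁.restrictDiffeomorph b₂ A).trans (σ₂.trans (b₁'.restrictDiffeomorph b₂' B).symm)
  let tw : (RegularSublevel h₁ ≃ₘ⟮𝓡∂ (1 + 1), 𝓡∂ (1 + 1)⟯ RegularSublevel h₂) →
      (RegularSuperlevel h₁ ≃ₘ⟮𝓡∂ (1 + 1), 𝓡∂ (1 + 1)⟯ RegularSuperlevel h₂) →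
      (b₁'.carrier ≃ₘ⟮𝓡 1, 𝓡 1⟯ b₁'.carrier) := fun A B => σ₁.symm.trans (ψ A B)
  -- the twist on points: only the outermost factor depends on `B`
  have tw_val : ∀ A B (w : b₁'.carrier),
      (tw A B w).1 = B.symm (σ₂ (b₁.restrictDiffeomorph b₂ A (σ₁.symm w))).1 := by
    intro A B w
    show b₁'.incl ((b₁'.restrictDiffeomorph b₂' B).symm
      (σ₂ (b₁.restrictDiffeomorph b₂ A (σ₁.symm w)))) = _
    rw [BoundaryData.restrictDiffeomorph_symm, BoundaryData.coe_restrictDiffeomorph]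
    exact BoundaryData.incl_restrictEquiv (b₁ := b₂') (b₂ := b₁') B.symm _
  -- Step 1: `B` with matching ends
  set A : RegularSublevel h₁ ≃ₘ⟮𝓡∂ (1 + 1), 𝓡∂ (1 + 1)⟯ RegularSublevel h₂ :=
    T₁.trans T₂.symm with hA
  have hends : ∃ B : RegularSuperlevel h₁ ≃ₘ⟮𝓡∂ (1 + 1), 𝓡∂ (1 + 1)⟯ RegularSuperlevel h₂,
      ∀ w : b₁'.carrier, (T₁' (tw A B w).1).2 = (T₁' w.1).2 := by
    haveI : Nonempty (Metric.sphere (0 : EuclideanSpace ℝ (Fin (1 + 1))) 1) := ⟨sphereBasePoint 1⟩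
    haveI : ConnectedSpace (Metric.sphere (0 : EuclideanSpace ℝ (Fin (1 + 1))) 1) := by
      refine isConnected_iff_connectedSpace.mp (isConnected_sphere ?_ 0 zero_le_one)
      rw [← Module.finrank_eq_rank, finrank_euclideanSpace_fin]
      norm_num
    set B₀ : RegularSuperlevel h₁ ≃ₘ⟮𝓡∂ (1 + 1), 𝓡∂ (1 + 1)⟯ RegularSuperlevel h₂ :=
      T₁'.trans T₂'.symm with hB₀
    rcases forall_snd_eq_or_forall_snd_eq_flipIcc T₁' (tw A B₀) with hE | hE
    · exact ⟨B₀, hE⟩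
    · obtain ⟨X, hX⟩ := exists_diffeomorph_endSwap T₁'
      have hXX : ∀ q, X (X q) = q := fun q => by
        have h1 : T₁' (X (X q)) = T₁' q := by
          rw [hX, hX]
          simp
        rw [← T₁'.symm_apply_apply (X (X q)), h1, T₁'.symm_apply_apply]
      have hXsymm : ∀ q, X.symm q = X q := fun q => by
        conv_lhs => rw [← hXX q]
        exact X.symm_apply_apply (X q)
      have hsymm : ∀ q, (X.trans B₀).symm q = X.symm (B₀.symm q) := fun q => rfl
      refine ⟨X.trans B₀, fun w => ?_⟩
      rw [tw_val, hsymm, hXsymm, hX]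
      show SmoothFill.flipIcc (T₁' (B₀.symm (σ₂ (b₁.restrictDiffeomorph b₂ A (σ₁.symm w))).1)).2 = _
      rw [← tw_val A B₀ w,
        show (T₁' (tw A B₀ w).1).2 = SmoothFill.flipIcc (T₁' w.1).2 from hE w,
        SmoothFill.flipIcc_flipIcc]
  obtain ⟨B₁, hE₁⟩ := hends
  -- Step 2: `B` with matching ends and matching orientation character
  have hboth : ∃ B : RegularSuperlevel h₁ ≃ₘ⟮𝓡∂ (1 + 1), 𝓡∂ (1 + 1)⟯ RegularSuperlevel h₂,
      (∀ w : b₁'.carrier, (T₁' (tw A B w).1).2 = (T₁' w.1).2) ∧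
      (A.IsOrientationPreserving ω₁ ω₂ ↔ B.IsOrientationPreserving ω₁' ω₂') := by
    by_cases hc : (A.IsOrientationPreserving ω₁ ω₂ ↔ B₁.IsOrientationPreserving ω₁' ω₂')
    · exact ⟨B₁, hE₁, hc⟩
    · obtain ⟨R, hR, hRsymm, hRrev⟩ := exists_diffeomorph_isOrientationReversing_snd_eq T₁' ω₁'
      have hsymm : ∀ q, (R.trans B₁).symm q = R.symm (B₁.symm q) := fun q => rfl
      refine ⟨R.trans B₁, fun w => ?_, ?_⟩
      · rw [tw_val, hsymm, hRsymm, ← tw_val A B₁ w, hE₁]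
      · rw [isOrientationPreserving_trans_iff_not_of_isOrientationReversing hRrev B₁ ω₂']
        constructor
        · intro ha hb
          exact hc ⟨fun _ => hb, fun _ => ha⟩
        · intro hb
          by_contra ha
          exact hc ⟨fun ha' => absurd ha' ha, fun hb' => absurd hb' hb⟩
  obtain ⟨B, hE, hchar⟩ := hboth
  -- Step 3: the twist preserves the boundary orientation of `S₁'`
  set dA := b₁.restrictDiffeomorph b₂ A with hdA
  set dB := b₁'.restrictDiffeomorph b₂' B with hdB
  have hdAρ : ∀ z : b₁.carrier, (dA z).1 = A z.1 := fun z =>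
    BoundaryData.incl_restrictDiffeomorph (b₁ := b₁) (b₂ := b₂) A z
  have hdBρ : ∀ z : b₁'.carrier, (dB z).1 = B z.1 := fun z =>
    BoundaryData.incl_restrictDiffeomorph (b₁ := b₁') (b₂ := b₂') B z
  have hmid : (dA.trans (σ₂.trans dB.symm)).IsOrientationPreserving ω₁.boundary (-ω₁'.boundary) := by
    rcases Diffeomorph.isOrientationPreserving_or_isOrientationReversing_holds A (by simp) ω₁ ω₂
      with hApres | hArev
    · have hBpres : B.IsOrientationPreserving ω₁' ω₂' := hchar.mp hApres
      have h1 : dA.IsOrientationPreserving ω₁.boundary ω₂.boundary :=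
        Diffeomorph.isOrientationPreserving_boundaryMap A hdAρ hApres
      have h3 : dB.IsOrientationPreserving ω₁'.boundary ω₂'.boundary :=
        Diffeomorph.isOrientationPreserving_boundaryMap B hdBρ hBpres
      have h3' : dB.symm.IsOrientationPreserving (-ω₂'.boundary) (-ω₁'.boundary) :=
        (isOrientationPreserving_neg_neg_iff _ _ _).mpr
          (Diffeomorph.IsOrientationPreserving.symm_holds h3 (by simp))
      have h23 := Diffeomorph.IsOrientationPreserving.trans_holds hσ₂ h3' (by simp)
      exact Diffeomorph.IsOrientationPreserving.trans_holds h1 h23 (by simp)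
    · have hBrev : B.IsOrientationReversing ω₁' ω₂' := by
        rcases Diffeomorph.isOrientationPreserving_or_isOrientationReversing_holds B (by simp)
          ω₁' ω₂' with hB | hB
        · exact absurd (hchar.mpr hB) (IsOrientationPreserving.not_isOrientationReversing · hArev)
        · exact hB
      have h1 : dA.IsOrientationPreserving ω₁.boundary (-ω₂.boundary) :=
        Diffeomorph.isOrientationReversing_boundaryMap A hdAρ hArev
      have hσ₂' : IsOrientationPreserving (-ω₂.boundary) ω₂'.boundary ⇑σ₂ := by
        rw [← isOrientationPreserving_neg_neg_iff, neg_neg]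
        exact hσ₂
      have h3 : dB.IsOrientationPreserving ω₁'.boundary (-ω₂'.boundary) :=
        Diffeomorph.isOrientationReversing_boundaryMap B hdBρ hBrev
      have h3' : IsOrientationPreserving ω₂'.boundary (-ω₁'.boundary) ⇑dB.symm := by
        have h : IsOrientationPreserving (-ω₂'.boundary) ω₁'.boundary ⇑dB.symm :=
          Diffeomorph.IsOrientationPreserving.symm_holds h3 (by simp)
        rw [← isOrientationPreserving_neg_neg_iff, neg_neg]
        exact h
      have h23 := Diffeomorph.IsOrientationPreserving.trans_holds hσ₂' h3' (by simp)
      exact Diffeomorph.IsOrientationPreserving.trans_holds h1 h23 (by simp)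
  have hσ₁' : σ₁.symm.IsOrientationPreserving (-ω₁'.boundary) ω₁.boundary :=
    Diffeomorph.IsOrientationPreserving.symm_holds hσ₁ (by simp)
  have hP : IsOrientationPreserving ω₁'.boundary ω₁'.boundary ⇑(tw A B) := by
    have h := Diffeomorph.IsOrientationPreserving.trans_holds hσ₁' hmid (by simp)
    exact (isOrientationPreserving_neg_neg_iff _ _ _).mp h
  -- Step 4: extend the twist over `S₁'` and re-glue
  obtain ⟨Φ, hΦ⟩ := exists_diffeomorph_extends_of_isOrientationPreserving T₁' ω₁' (tw A B) hE hP
  have hG₁ : IsBoundaryGluing b₁ b₁' σ₁ (𝓡 (1 + 1)) M₁ := RegularSublevel.isBoundaryGluing_split h₁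
  have hG₂ : IsBoundaryGluing b₂ b₂' σ₂ (𝓡 (1 + 1)) M₂ := RegularSublevel.isBoundaryGluing_split h₂
  have hG₂' : IsBoundaryGluing b₁ b₁' (ψ A B) (𝓡 (1 + 1)) M₂ := hG₂.of_diffeomorph_pieces A B
  have hG₂'' : IsBoundaryGluing b₁ b₁' σ₁ (𝓡 (1 + 1)) M₂ :=
    hG₂'.comp_diffeomorph_right Φ (tw A B).toEquiv (fun w => hΦ w) fun z => by
      show (σ₁.symm.trans (ψ A B)) (σ₁ z) = ψ A B z
      rw [Diffeomorph.coe_trans, comp_apply, Diffeomorph.symm_apply_apply]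
      rfl
  exact nonempty_diffeomorph_of_isBoundaryGluing_holds hG₁ hG₂''

/-- **Uniqueness of the torus.** Any two closed oriented surfaces (compact, without boundary,
carrying smooth orientations) which admit Morse functions with exactly one critical point of
index `0`, two of index `1` and one of index `2` are diffeomorphic: by the cutting theorem
(`exists_nonempty_diffeomorph_sublevel_superlevel_cylinder`, `SurfaceLevelCylinders.lean`) each is
cut by a regular level into two annuli, and `nonempty_diffeomorph_of_cylinder_halves` applies.
Hirsch, *Differential Topology* (1976), Ch. 9 §3, Thm. 3.5 with Thm. 3.7 (classification of
compact connected orientable surfaces by the genus; genus one); Matsumoto, *An introduction to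
Morse theory* (2001), §1.5 (b) ("one minimum, two saddles, one maximum: the torus").
[cite: HirschDT1976, Ch. 9 §3, Thm. 3.5 and Thm. 3.7] -/
theorem nonempty_diffeomorph_of_isMorse_one_two_one [SecondCountableTopology M₁]
    [T2Space M₂] [CompactSpace M₂] [SecondCountableTopology M₂]
    (o₁ : SmoothOrientation (𝓡 2) M₁) {f₁ : M₁ → ℝ} (hf₁ : IsMorse (𝓡 2) f₁) {pbot₁ ptop₁ : M₁}
    (hbot₁ : criticalSetOfIndex (𝓡 2) f₁ 0 = {pbot₁})
    (htop₁ : criticalSetOfIndex (𝓡 2) f₁ 2 = {ptop₁})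
    (hsad₁ : (criticalSetOfIndex (𝓡 2) f₁ 1).ncard = 2)
    (o₂ : SmoothOrientation (𝓡 2) M₂) {f₂ : M₂ → ℝ} (hf₂ : IsMorse (𝓡 2) f₂) {pbot₂ ptop₂ : M₂}
    (hbot₂ : criticalSetOfIndex (𝓡 2) f₂ 0 = {pbot₂})
    (htop₂ : criticalSetOfIndex (𝓡 2) f₂ 2 = {ptop₂})
    (hsad₂ : (criticalSetOfIndex (𝓡 2) f₂ 1).ncard = 2) :
    Nonempty (M₁ ≃ₘ⟮𝓡 2, 𝓡 2⟯ M₂) := by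
  obtain ⟨g₁, c₁, -, h₁, -, ⟨T₁⟩, ⟨T₁'⟩⟩ :=
    exists_nonempty_diffeomorph_sublevel_superlevel_cylinder o₁ hf₁ hbot₁ htop₁ hsad₁
  obtain ⟨g₂, c₂, -, h₂, -, ⟨T₂⟩, ⟨T₂'⟩⟩ :=
    exists_nonempty_diffeomorph_sublevel_superlevel_cylinder o₂ hf₂ hbot₂ htop₂ hsad₂
  exact nonempty_diffeomorph_of_cylinder_halves h₁ o₁ T₁ T₁' h₂ o₂ T₂ T₂'

end Assembly

end Literature.Topology.FourManifolds
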